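import Summits.NavierStokesRegularity.NavierStokesRegularity.Theorems.SoloRefuteTibola2025
import HarnessLib

/-!
# Solo refutation — C173 `Tibola2025`, PART C (records ADDENDUM): the literal ball face of (12.12)

D-0090 «where NS proofs break» map, cell `ns-claims`; refuter of record ns-claims-refuter-6 g5. Imports PART B
(`SoloRefuteTibola2025`, hence PART A and the skeleton `Literature.Claims.NS.Tibola2025`, p550041). The skeleton
records Lemma 12.20's display (12.12) p.32 l.57–64 ALSO with Φ exactly as printed — `PhiBall u π ρ x₀ t =
∫_{B_ρ(x₀)} |u(t)|³ + ∫_{B_ρ(x₀)} |π(t)|^{3/2}` at a fixed time, no power of ρ — as `Step_L1220_ball K L ν`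
(l.342; NOT consumed by `claim_of_steps`, recorded for the referee). This file shows that face is false as well,
by the SAME witness (PART A; switch-on at `s = 0`, `δ = 1/24`): at `t = 1`, `ρ = 1/12` (`6ρ = 1/2`),
`x₀ = proj(½,½,½)` both balls `B_ρ ⊂ B_{6ρ}` contain the support of the slice, so `Φ_ball(ρ) = Φ_ball(6ρ) = m`
with `m ∈ (0, ∞)` (`setLIntegral_ball_eq`, `lintegral_slice_pos`, `lintegral_slice_lt_top`), and the display
`m ≤ θ(6)·m` forces `θ(6) ≥ 1` against Cor 12.21 (`Step_C1221`). Hence BOTH typed readings of Lemma 12.20 fail,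
in particular at the printed certificate `θ(6) = 0.693…` (`not_Step_L1220_ball_table4`). Records-grade: the head
of record stays `Step_L1220_of` / `not_Step_L1220_of` (PART B).

WHAT THIS IS NOT: not a claim about NS regularity or blow-up; not a claim about any author beyond the typed
locator. [cite: Tibola2025]
-/

set_option linter.dupNamespace false

noncomputable section

open Set Function Metric MeasureTheory
open scoped ContDiff ENNReal

namespace Summit.NavierStokesRegularity.NavierStokesRegularity.Theorems.Tibola2025

open Literature.Analysis.FunctionSpaces Literature.Analysis.FunctionSpaces.Torus
open Literature.Claims.NS.Tibola2025 (IsDatum IsForce URKit Ledger PhiBall Step_C1221 Step_L1220 Step_L1220_ball)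

variable {δ : ℝ}

/-! ## Space-ball masses of a time slice (`ℝ≥0∞`) -/

/-- For `G 0 = 0`, the mass of `G ∘ u(t, ·)` on a torus ball of radius `R > δ` about `proj q` is its total
mass (the slice vanishes at torus distance `> δ`). [folklore] -/
theorem setLIntegral_ball_eq (hδ : 0 < δ) (hδ' : δ < 1 / 2) {R : ℝ} (hR : δ < R) (s t : ℝ) (G : E3 → ℝ≥0∞)
    (hG : G 0 = 0) : ∫⁻ x in ball (proj qc) R, G (vel δ s t x) = ∫⁻ x, G (vel δ s t x) := by
  refine setLIntegral_eq_of_support_subset fun x hx => ?_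
  have hv : vel δ s t x ≠ 0 := fun h => hx (by simp only [h, hG])
  have hV : V δ x ≠ 0 := fun h => hv (by simp [vel, h])
  exact mem_ball.2 (lt_of_le_of_lt (dist_le_of_V_ne_zero hδ hδ' hV) hR)

/-- After the switch-on time the slice mass of `G ∘ u(t, ·)` is positive (`G v ≠ 0` for `v ≠ 0`). [folklore] -/
theorem lintegral_slice_pos (hδ : 0 < δ) (hδ' : δ < 1 / 2) {s t : ℝ} (hst : s < t) (G : E3 → ℝ≥0∞)
    (hGm : Measurable G) (hGp : ∀ v, v ≠ 0 → G v ≠ 0) : 0 < ∫⁻ x, G (vel δ s t x) := by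
  have hc : Continuous (vel δ s t) := ((isSmooth_V hδ).smul (sw s t)).continuous
  have hmeas : Measurable fun x : T3 => G (vel δ s t x) := hGm.comp hc.measurable
  rw [lintegral_pos_iff_support hmeas]
  have hO : IsOpen {x : T3 | V δ x ≠ 0} := isOpen_ne_fun (isSmooth_V hδ).continuous continuous_const
  obtain ⟨x, hx⟩ := exists_V_ne_zero hδ hδ'
  refine lt_of_lt_of_le (hO.measure_pos volume ⟨x, hx⟩) (measure_mono fun y hy => ?_)
  exact hGp _ (by simpa [vel, (sw_pos hst).ne'] using hy)

/-- The slice mass of a continuous finite-valued `G ∘ u(t, ·)` is finite (compact torus). [folklore] -/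
theorem lintegral_slice_lt_top (hδ : 0 < δ) (s t : ℝ) (G : E3 → ℝ≥0∞) (hGc : Continuous G)
    (hGf : ∀ v, G v ≠ ⊤) : ∫⁻ x, G (vel δ s t x) < ⊤ := by
  have hc : Continuous fun x : T3 => G (vel δ s t x) :=
    hGc.comp ((isSmooth_V hδ).smul (sw s t)).continuous
  obtain ⟨x₀, _, hx₀⟩ := isCompact_univ.exists_isMaxOn univ_nonempty hc.continuousOn
  calc ∫⁻ x, G (vel δ s t x) ≤ ∫⁻ _ : T3, G (vel δ s t x₀) := lintegral_mono fun x => hx₀ (mem_univ x)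
    _ = G (vel δ s t x₀) * volume (univ : Set T3) := lintegral_const _
    _ < ⊤ := ENNReal.mul_lt_top (hGf _).lt_top (measure_lt_top _ _)

/-! ## The literal ball face of (12.12) is false too -/

/-- **RECORDS KILL — the LITERAL face `Step_L1220_ball K L ν` (skeleton l.342, (12.12) with Φ exactly as
displayed: space balls at a fixed time, no power of ρ; NOT consumed by `claim_of_steps`) is FALSE for every kit,
every ledger with Cor 12.21's `θ(6) < 1` and every `ν`.** Same witness (switch-on at `s = 0`, `δ = 1/24`); at
`t = 1`, `ρ = 1/12` (`6ρ = 1/2`), `x₀ = proj q` the balls `B_ρ ⊂ B_{6ρ}` both contain the slice's support, so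
`Φ_ball(ρ) = Φ_ball(6ρ) = m ∈ (0, ∞)` and the display reads `m ≤ θ(6)·m`, i.e. `θ(6) ≥ 1`.
[cite: Tibola2025, Lemma 12.20 (12.12) p.32 l.57–64] -/
theorem not_Step_L1220_ball (K : URKit) (L : Ledger) (h1221 : Step_C1221 L) (ν : ℝ) :
    ¬ Step_L1220_ball K L ν := by
  intro h
  obtain ⟨δ, hδdef⟩ : ∃ δ : ℝ, δ = 1 / 24 := ⟨_, rfl⟩
  have hδ : 0 < δ := by rw [hδdef]; norm_num
  have hδ' : δ < 1 / 2 := by rw [hδdef]; norm_num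
  have key := h (vel δ 0 0) (force ν δ 0) (vel δ 0) (isDatum_vel ν hδ hδ' 0 0) (isForce_force ν hδ 0)
    (isGlobalLerayHopf_witness ν hδ hδ' 0) (1 / 12) (proj qc) 1 (by norm_num) (by norm_num) one_pos
  rw [press_witness K ν hδ hδ' 0] at key
  set G : E3 → ℝ≥0∞ := fun v => ‖v‖ₑ ^ (3 : ℕ) with hG
  have h32 : (0 : ℝ) < 3 / 2 := by norm_num
  have hG0 : G 0 = 0 := by simp [hG]
  have hGm : Measurable G := measurable_enorm.pow_const _
  have hGp : ∀ v, v ≠ 0 → G v ≠ 0 := fun v hv => pow_ne_zero _ (by simpa [hG] using hv)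
  have hGc : Continuous G := (ENNReal.continuous_pow 3).comp continuous_enorm
  have hGf : ∀ v, G v ≠ ⊤ := fun v => ENNReal.pow_ne_top enorm_ne_top
  have hΦ : ∀ ρ : ℝ, δ < ρ → PhiBall (vel δ 0) pres ρ (proj qc) 1 = ∫⁻ x, G (vel δ 0 1 x) := by
    intro ρ hρ
    have hp : ∀ x : T3, ‖pres 1 x‖ₑ ^ (3 / 2 : ℝ) = 0 := fun x => by
      simp [pres, ENNReal.zero_rpow_of_pos h32]
    simp only [PhiBall, hp, lintegral_zero, add_zero]
    exact setLIntegral_ball_eq hδ hδ' hρ 0 1 G hG0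
  rw [hΦ (1 / 12) (by rw [hδdef]; norm_num), hΦ (6 * (1 / 12)) (by rw [hδdef]; norm_num)] at key
  set m := ∫⁻ x, G (vel δ 0 1 x) with hm
  have hm0 : m ≠ 0 := (lintegral_slice_pos hδ hδ' one_pos G hGm hGp).ne'
  have hmt : m ≠ ⊤ := (lintegral_slice_lt_top hδ 0 1 G hGc hGf).ne
  have key' : 1 * m ≤ ENNReal.ofReal (L.theta 6) * m := by rwa [one_mul]
  have h1 := (ENNReal.mul_le_mul_iff_left hm0 hmt).1 key'
  rw [← ENNReal.ofReal_one] at h1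
  rcases ENNReal.ofReal_le_ofReal_iff'.1 h1 with h' | h'
  · exact absurd h1221 (not_lt.2 h')
  · exact absurd h' (by norm_num)

/-- Both typed faces of Lemma 12.20 fail at the printed certificate `θ(6) = 0.693…` (`ledgerTable4`), for every
kit and every viscosity. [cite: Tibola2025, Lemma 12.20 (12.12) p.32 l.55–66; p.48 l.12–13] -/
theorem not_Step_L1220_ball_table4 (K : URKit) (ν : ℝ) :
    ¬ Step_L1220_ball K ledgerTable4 ν ∧ ¬ Step_L1220 K ledgerTable4 ν :=
  ⟨not_Step_L1220_ball K ledgerTable4 step_C1221_ledgerTable4.1 ν, not_Step_L1220_table4 K ν⟩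

end Summit.NavierStokesRegularity.NavierStokesRegularity.Theorems.Tibola2025

end
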